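import Summits.MatrixMultiplication.MatrixMultiplication.Theses.LinearSolveSplit
import Summits.MatrixMultiplication.MatrixMultiplication.Theorems.LinearSolveSplitDetSolveMassThreeGeneric

/-!
# `DetSolveMassThree` — rung `ℓ = 3` of the solve-mass ladder of route LinearSolveSplit (proof)

Item `stmt-MatrixMultiplication-26151` (`Theses.LinearSolveSplit.DetSolveMassThree`, aside / support
rung of `route-MatrixMultiplication-LinearSolveSplit`, decomp-mm lens 3): for every `a > 2` and every
query-size threshold `m₀`, for all large `n`, the determinant of the generic `n × n` matrix `X` is
`Derivable` over `ℂ(X)` in `≤ C·n^a` counted steps (constants free) by a straight-line program with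
division that may, in rounds, write down GENERIC linear systems `[X' | b']` of sizes `m₀ ≤ N ≤ n`
(presented along `ℂ`-algebra maps of fields `ℂ(Z_{N×(N+1)}) →ₐ[ℂ] ℂ(X)`) and receives their solutions
for free, the total MASS `Σ N²` of the queries being `≤ C·n³`.

Proof (Gaussian / Schur telescoping, Strassen 1969 p. 356; BCS 1997 (16.7) step (A)): the queries
are the generic sub-systems `[X_{<k} | (x_{ik})_{i<k}]`, `k = m₀, …, n − 1` (sub-blocks of `X`, hence
generic: the embedding is `IsFractionRing.liftAlgHom ∘ MvPolynomial.rename` of an injective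
renaming), answered by `u_k = X_{<k}⁻¹ c_k`; the program then computes the Schur pivots
`d_k = x_{kk} − Σ_{j<k} x_{kj} u_{k,j}` (`2k + 1` steps each, `≤ n²` in total), the leading minor
`det X_{<m₀}` by Leibniz (`m₀!·m₀ + m₀!` steps, independent of `n`) and the product
`det X = det X_{<m₀} · ∏_{k=m₀}^{n−1} d_k` (`n − m₀ + 1` steps); the mass is `Σ_{k=m₀}^{n−1} k² ≤ n³`.
The block identity `det X_{≤k} = det X_{<k} · d_k` is Mathlib's `Matrix.det_fromBlocks₁₁` after
reindexing `Fin (k+1) ≃ Fin k ⊕ Fin 1`; invertibility of the generic leading blocks is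
`Matrix.det_mvPolynomialX_ne_zero` transported along the (injective) sub-block renaming.

Main theorem: `detSolveMassThree_holds : Theses.LinearSolveSplit.DetSolveMassThree` (0 sorry).

Landing note: the lens-3 kernel `DetSolveMassThree.lean` (decomp-mm gen 4; sha256 75ad05e5…edaf, 490 lines, rc 0 ·
0 sorry · std axioms, critic-endorsed 2026-08-30T04:50:40Z) is landed as two files for the gate rule «Theorems files with
proofs ≤ 400 lines» — `LinearSolveSplitDetSolveMassThreeGeneric` (§§1–3: SLP cost lemmas, the generic matrices and
their leading blocks / Schur telescoping, the embedded generic query systems; imports no route file) and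
`LinearSolveSplitDetSolveMassThree` (§§4–6: the rounds, step counts, and the closer `detSolveMassThree_holds`);
statements and proofs unchanged (20 helper docstrings added), one namespace throughout.
-/

set_option linter.dupNamespace false -- `MatrixMultiplication.MatrixMultiplication` (summit = problem, D-0017)

noncomputable section

open scoped BigOperators
open Literature.Computability.AlgebraicComplexity (Derivable DivStep DivSeq)

namespace Summit.MatrixMultiplication.MatrixMultiplication.Theorems.LinearSolveSplitDetSolveMassThree

/-! ## 4. The rounds: available sets `A i` -/

/-- The solution coordinates received in round `i` (query `k = m₀ + i`). -/
def Sol (n m₀ i : ℕ) : Set (GF n n) :=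
  if h : m₀ + i + 1 ≤ n then
    Set.range (fun j : Fin (m₀ + i) => emb n (m₀ + i) h (sysSolution (m₀ + i) j))
  else ∅

/-- The available set after `i` rounds (no intermediate arithmetic: `B_i = A_i`). -/
def chain (n m₀ : ℕ) : ℕ → Set (GF n n)
  | 0 => Set.range (gE n n)
  | i + 1 => chain n m₀ i ∪ chain n m₀ i ∪ Sol n m₀ i

/-- One round: `chain (i+1) = chain i ∪ chain i ∪ Sol i` (definitional). -/
theorem chain_succ (n m₀ i : ℕ) :
    chain n m₀ (i + 1) = chain n m₀ i ∪ chain n m₀ i ∪ Sol n m₀ i := rfl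

/-- The available sets `chain n m₀ i` increase with the round index. -/
theorem chain_mono {n m₀ i i' : ℕ} (h : i ≤ i') : chain n m₀ i ⊆ chain n m₀ i' := by
  induction h with
  | refl => exact subset_rfl
  | step _ ih => exact ih.trans fun x hx => Or.inl (Or.inl hx)

/-- Every variable `x_{ij}` is available in every round. -/
theorem range_subset_chain (n m₀ i : ℕ) : Set.range (gE n n) ⊆ chain n m₀ i :=
  chain_mono (i := 0) (Nat.zero_le i)

/-- The solution `u_{m₀+i}` of the `i`-th query is available from round `i+1` on. -/
theorem uk_mem_chain {n m₀ i q : ℕ} (h : m₀ + i + 1 ≤ n) (hi : i < q) (j : Fin (m₀ + i)) :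
    uk n (m₀ + i) j ∈ chain n m₀ q := by
  refine chain_mono (Nat.succ_le_of_lt hi) ?_
  rw [chain_succ]
  refine Or.inr ?_
  rw [Sol, dif_pos h]
  exact ⟨j, emb_sysSolution h j⟩

/-! ## 5. Step counts -/

/-- `d_k` costs `2k + 1` steps once `u_k` is available. -/
theorem derivable_dk {n k : ℕ} {A : Set (GF n n)} (hV : Set.range (gE n n) ⊆ A)
    (hu : ∀ j : Fin k, uk n k j ∈ A) (hk : k < n) : Derivable ℂ (k + k + 1) A {dk n k} := by
  classical
  have hp : Derivable ℂ k A (⋃ j ∈ (Finset.univ : Finset (Fin k)), {xe n k j * uk n k j}) := by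
    have h := Derivable.biUnion (k := ℂ) (Finset.univ : Finset (Fin k)) (c := fun _ => 1) (A := A)
      (B := fun j => {xe n k j * uk n k j})
      (fun j _ => Derivable.mul (k := ℂ) (Or.inl (hV (xe_mem hk (lt_trans j.2 hk)))) (Or.inl (hu j)))
    rw [Finset.sum_const, smul_eq_mul, mul_one, Finset.card_univ, Fintype.card_fin] at h
    exact h
  have hs : Derivable ℂ k (A ∪ ⋃ j ∈ (Finset.univ : Finset (Fin k)), {xe n k j * uk n k j})
      {∑ j ∈ (Finset.univ : Finset (Fin k)), (1 : ℂ) • (xe n k j * uk n k j)} := by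
    have h := Derivable.sum (k := ℂ) (Finset.univ : Finset (Fin k)) (fun _ => (1 : ℂ))
      (A := A ∪ ⋃ j ∈ (Finset.univ : Finset (Fin k)), {xe n k j * uk n k j})
      (x := fun j => xe n k j * uk n k j)
      (fun j hj => Or.inl (Or.inr (Set.mem_iUnion₂.mpr ⟨j, hj, rfl⟩)))
    rw [Finset.card_univ, Fintype.card_fin] at h
    exact h
  have hps := hp.trans hs
  simp only [one_smul] at hps
  have hl : Derivable ℂ 1 (A ∪ {∑ j : Fin k, xe n k j * uk n k j})
      {(1 : ℂ) • xe n k k + (-1 : ℂ) • ∑ j : Fin k, xe n k j * uk n k j} :=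
    Derivable.lin (k := ℂ) (A := A ∪ {∑ j : Fin k, xe n k j * uk n k j}) (x := xe n k k)
      (y := ∑ j : Fin k, xe n k j * uk n k j)
      (Or.inl (Or.inl (hV (xe_mem hk hk)))) (Or.inl (Or.inr rfl)) 1 (-1)
  have h := hps.trans hl
  rw [one_smul, neg_one_smul, ← sub_eq_add_neg] at h
  exact h

/-- Step count of the pivots: `Σ_{k=m₀}^{n−1} (2k+1) ≤ n²`. -/
theorem sum_Ico_le_sq (m₀ n : ℕ) : ∑ k ∈ Finset.Ico m₀ n, (k + k + 1) ≤ n ^ 2 := by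
  calc ∑ k ∈ Finset.Ico m₀ n, (k + k + 1) ≤ ∑ k ∈ Finset.range n, (k + k + 1) :=
        Finset.sum_le_sum_of_subset fun k hk => by
          simp only [Finset.mem_Ico, Finset.mem_range] at hk ⊢
          exact hk.2
    _ = n ^ 2 := by
        induction n with
        | zero => simp
        | succ n ih => rw [Finset.sum_range_succ, ih]; ring

/-- Mass of the queries: `Σ_{k=m₀}^{n−1} k² ≤ n³`. -/
theorem mass_le_cube {m₀ n : ℕ} (h : m₀ ≤ n) :
    ∑ i ∈ Finset.range (n - m₀), (m₀ + i) ^ 2 ≤ n ^ 3 := by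
  calc ∑ i ∈ Finset.range (n - m₀), (m₀ + i) ^ 2 ≤ (Finset.range (n - m₀)).card • n ^ 2 :=
        Finset.sum_le_card_nsmul _ _ _ fun i hi => by
          have hi' : m₀ + i ≤ n := by
            rw [Finset.mem_range] at hi
            omega
          exact Nat.pow_le_pow_left hi' 2
    _ ≤ n ^ 3 := by
        rw [Finset.card_range, smul_eq_mul]
        calc (n - m₀) * n ^ 2 ≤ n * n ^ 2 := Nat.mul_le_mul_right _ (Nat.sub_le n m₀)
          _ = n ^ 3 := by ring

/-- **The whole program**: from the entries of `X` and the oracle answers `u_k` (`m₀ ≤ k < n`),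
`det X` is derivable in `≤ m₀!·m₀ + m₀! + n² + n + 1` steps. -/
theorem derivable_genDet {n m₀ : ℕ} (h : m₀ ≤ n) :
    Derivable ℂ (m₀.factorial * m₀ + m₀.factorial + n ^ 2 + (n + 1)) (chain n m₀ (n - m₀))
      {genDet n} := by
  classical
  have hV : Set.range (gE n n) ⊆ chain n m₀ (n - m₀) := range_subset_chain _ _ _
  -- the leading block, by Leibniz
  have hD : Derivable ℂ (m₀.factorial * m₀ + m₀.factorial) (chain n m₀ (n - m₀)) {Dk n m₀} :=
    derivable_det (Xk n m₀) fun i j =>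
      Or.inl (hV (xe_mem (lt_of_lt_of_le i.2 h) (lt_of_lt_of_le j.2 h)))
  -- the Schur pivots
  have hd : Derivable ℂ (∑ k ∈ Finset.Ico m₀ n, (k + k + 1)) (chain n m₀ (n - m₀))
      (⋃ k ∈ Finset.Ico m₀ n, {dk n k}) :=
    Derivable.biUnion (k := ℂ) (Finset.Ico m₀ n) (c := fun k => k + k + 1)
      (A := chain n m₀ (n - m₀)) (B := fun k => {dk n k}) fun k hk => by
        obtain ⟨hmk, hkn⟩ := Finset.mem_Ico.mp hk
        obtain ⟨i, rfl⟩ := Nat.exists_eq_add_of_le hmk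
        exact derivable_dk hV (fun j => uk_mem_chain (by omega) (by omega) j) hkn
  have hT := hD.union (hd.mono (sum_Ico_le_sq m₀ n) subset_rfl subset_rfl)
  -- the product
  have hprod : Derivable ℂ (Finset.Ico m₀ n).card
      (chain n m₀ (n - m₀) ∪ ({Dk n m₀} ∪ ⋃ k ∈ Finset.Ico m₀ n, {dk n k}))
      {∏ k ∈ Finset.Ico m₀ n, dk n k} :=
    derivable_prod (Finset.Ico m₀ n) fun k hk =>
      Or.inl (Or.inr (Or.inr (Set.mem_iUnion₂.mpr ⟨k, hk, rfl⟩)))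
  have hmul : Derivable ℂ 1
      ((chain n m₀ (n - m₀) ∪ ({Dk n m₀} ∪ ⋃ k ∈ Finset.Ico m₀ n, {dk n k})) ∪
        {∏ k ∈ Finset.Ico m₀ n, dk n k})
      {Dk n m₀ * ∏ k ∈ Finset.Ico m₀ n, dk n k} :=
    Derivable.mul (k := ℂ) (Or.inl (Or.inl (Or.inr (Or.inl rfl)))) (Or.inl (Or.inr rfl))
  have hfin := hT.trans (hprod.trans hmul)
  rw [← genDet_eq_prod h, Nat.card_Ico] at hfin
  exact hfin.mono (by omega) subset_rfl subset_rfl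

/-! ## 6. The rung -/

/-- **`DetSolveMassThree` holds** (item stmt-MatrixMultiplication-26151): the generic determinant is
quadratic (indeed `O(n²)` plus a constant depending on the threshold `m₀`) modulo free generic solves
of total mass `≤ n³`. -/
theorem detSolveMassThree_holds :
    Summit.MatrixMultiplication.MatrixMultiplication.Theses.LinearSolveSplit.DetSolveMassThree := by
  intro a ha m₀
  refine ⟨((m₀.factorial * m₀ + m₀.factorial + 3 : ℕ) : ℝ), max m₀ 1, fun n hn => ?_⟩
  have hm : m₀ ≤ n := le_of_max_le_left hn
  have hn1 : 1 ≤ n := le_of_max_le_right hn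
  refine ⟨m₀.factorial * m₀ + m₀.factorial + n ^ 2 + (n + 1), n ^ 3, ?_, ?_, n - m₀, fun i => m₀ + i,
    fun _ => 0, fun i hi => emb n (m₀ + i) (show m₀ + i + 1 ≤ n by omega), chain n m₀, ?_, rfl, ?_,
    ?_, ?_⟩
  · -- arithmetic `≤ C · n^a`
    have hK : m₀.factorial * m₀ + m₀.factorial + n ^ 2 + (n + 1) ≤
        (m₀.factorial * m₀ + m₀.factorial + 3) * n ^ 2 := by
      have h1 : 1 ≤ n ^ 2 := Nat.one_le_pow _ _ hn1
      have h2 : n ≤ n ^ 2 := by nlinarith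
      generalize m₀.factorial * m₀ + m₀.factorial = K0
      have h3 := Nat.mul_le_mul_left K0 h1
      rw [mul_one] at h3
      rw [Nat.add_mul]
      omega
    have hcast : ((m₀.factorial * m₀ + m₀.factorial + n ^ 2 + (n + 1) : ℕ) : ℝ) ≤
        ((m₀.factorial * m₀ + m₀.factorial + 3 : ℕ) : ℝ) * (n : ℝ) ^ 2 := by
      exact_mod_cast hK
    refine hcast.trans (mul_le_mul_of_nonneg_left ?_ (by positivity))
    rw [← Real.rpow_two]
    exact Real.rpow_le_rpow_of_exponent_le (by exact_mod_cast hn1) ha.le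
  · -- mass `≤ C · n^3`
    have h3 : ((n ^ 3 : ℕ) : ℝ) = (n : ℝ) ^ (3 : ℝ) := by
      rw [show (3 : ℝ) = ((3 : ℕ) : ℝ) by norm_num, Real.rpow_natCast]
      push_cast
      ring
    rw [h3]
    have hC : (1 : ℝ) ≤ ((m₀.factorial * m₀ + m₀.factorial + 3 : ℕ) : ℝ) := by
      exact_mod_cast (by omega : 1 ≤ m₀.factorial * m₀ + m₀.factorial + 3)
    have hpos : 0 ≤ (n : ℝ) ^ (3 : ℝ) := by positivity
    nlinarith
  · -- query sizes
    intro i hi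
    show m₀ ≤ m₀ + i ∧ m₀ + i ≤ n
    constructor <;> omega
  · -- the rounds
    intro i hi
    refine ⟨chain n m₀ i, Derivable.refl (k := ℂ) _ _, ?_, ?_⟩
    · rintro _ ⟨p, rfl⟩
      exact range_subset_chain n m₀ i
        ⟨rho n (m₀ + i) (show m₀ + i + 1 ≤ n by omega) p, (emb_gE _ p).symm⟩
    · show chain n m₀ (i + 1) = _
      rw [chain_succ, Sol, dif_pos (show m₀ + i + 1 ≤ n by omega)]
      rfl
  · -- the final derivation and the arithmetic count
    refine ⟨m₀.factorial * m₀ + m₀.factorial + n ^ 2 + (n + 1), derivable_genDet hm, ?_⟩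
    simp
  · -- the mass count
    exact mass_le_cube hm

end Summit.MatrixMultiplication.MatrixMultiplication.Theorems.LinearSolveSplitDetSolveMassThree

end
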